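import Summits.AtomisticToContinuum.BoseEinsteinCondensation.Theorems.BECConjugateDominationHardCoreExtensionResidueTower
import Summits.AtomisticToContinuum.BoseEinsteinCondensation.Theorems.HardCoreExtension.Negative.HighDensityObstruction
import Summits.AtomisticToContinuum.BoseEinsteinCondensation.Theorems.HardCoreExtension.Negative.ScalingReductions
import Summits.AtomisticToContinuum.BoseEinsteinCondensation.Theorems.HardCoreExtension.Negative.UniformRepairNormalForm

/-!
# Line `third-law-current-floor` — skeleton v14 (lead c6: the residue re-registered in the form the landed transfer CONSUMES)
# for the crux `BECConjugateDomination.HardCoreExtension` (crux item stmt-AtomisticToContinuum-11786, rank 5, route `route-AtomisticToContinuum-BECConjugateDomination`)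

Crux (FIXED, by name): `HardCoreExtension := A → BoseEinsteinCondensation`, `A` = dilute ground-state BEC for every
potential of the route's smooth class. Honest shape (Disproof §1): `A` idle, the PERIODIC conjunct proved per potential
on the full admissible class and carried to the Dirichlet conjunct by the route's crux `BoundaryTransferWeak`
(stmt-0827) BY NAME. Mechanism (card `Ideas/third-law-current-floor.md`, leads c0–c5, 69 landed files): the bounded
truncations `min(v, n) ↑ v` at fixed `(N, L)` reach every admissible `v` from minimiser BEC of BOUNDED potentials
((α') energy convergence, landed for every admissible `v`; (β') a Ky Fan gap of the truncations uniform in the level,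
landed for bounded / locally bounded `v`, modulo Lemma G for hard cores); the route's infrared mechanism made
`R`-uniform (S1 + S2 ⇒ quadratic floor, S3 Lévy bound, S4 glue, all landed but S2/S3) supplies uniform minimiser BEC
U(R) over bounded potentials of range `≤ R`.

v14 (lead c6, 2026-08-16T22:45Z) — RESHAPE, nothing weakened in the composition, two stubs replaced by weaker ones:
the landed transfer consumes U(R) only on the truncation tower of the ONE potential transferred, and consumes the exotic
simplicity residue X_ess only through the truncation gap it yields (`…ResidueTower.lean`, p129328:
`periodicBEC_of_truncationTowerBEC`, `uniformTruncationKyFanGap_of_lemmaG_of_essGap`, `hardCoreExtension_of_towerBEC`).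
Hence the registered residue is now
* **T `stub_truncationTowerBEC`** — for every admissible `v`: minimiser BEC along the tower `min(v,n)`, uniform in the
  level `n` (dilute, eventually in `N`). BEC calibre (for bounded `v` it is minimiser BEC of `v`; for `hardCorePotential a`
  it is height-uniform SOFT-SPHERE minimiser BEC). Implied by v13's S2 ∧ S3 through the landed
  `uniformMinimiserBEC_of_bounds` (S2 → S3 → U(R)) and `truncationTowerBEC_of_uniformMinimiserBEC` (U(R) → T(v));
  S2/S3 are kept below as the route's sufficient mechanism (documentation, not registered obligations of v14).
* **G `stub_lemmaGConnected`** — unchanged (CONJECTURE, verbatim Disproof §13 `LemmaGConnected`).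
* **Γ_ess `stub_essExoticTruncationGap`** — the level-uniform truncation Ky Fan gap on the ESSENTIAL exotic class
  (no physical member); implied by v13's X_ess through the landed `uniformTruncationKyFanGap_of_diluteSimple`.
`HardCoreExtension_of hbt := hardCoreExtension_of_towerBEC T G Γ_ess hbt` (landed, p129328). No worker-sized stub
remains: T is thermodynamic-limit BEC (uniform along a tower), G is open in print, Γ_ess has no physical member.
History v1–v13 (leads c0–c5): see the cycle reports under `Lines/` and the tree copy of v13 (commit 64570a3212be).
-/

noncomputable section

namespace Summit.AtomisticToContinuum.BoseEinsteinCondensation.Cruxes.HardCoreExtension.ThirdLawCurrentFloorAlt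

open MeasureTheory Filter UnitAddTorus
open scoped ENNReal NNReal BigOperators Topology InnerProductSpace ComplexConjugate
open Literature.MathematicalPhysics.QuantumManyBody.BoseGas
open Literature.Analysis.FunctionSpaces
open Summit.AtomisticToContinuum.BoseEinsteinCondensation.Theses.BECConjugateDomination
open Summit.AtomisticToContinuum.BoseEinsteinCondensation.Cruxes.HardCoreExtension.ThirdLawCurrentFloor

-- The measure on `ℝ/ℤ` is the Haar PROBABILITY measure, as in `PeriodicFormDomain.lean` and in the landed files
-- (needed only to STATE v13's X_ess in the documentation lemma `essGap_of_essExotic` below).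
attribute [local instance] Literature.MathematicalPhysics.QuantumManyBody.BoseGas.formDomain_measureSpace
  Literature.MathematicalPhysics.QuantumManyBody.BoseGas.formDomain_isProbabilityMeasure
  Literature.MathematicalPhysics.QuantumManyBody.BoseGas.formDomain_isProbabilityMeasure_pi

set_option linter.unusedVariables false

/-! ## T — truncation-tower minimiser BEC for every admissible potential (BEC CALIBRE; the consumed thermodynamic input) -/

/-- **T `stub_truncationTowerBEC`** (the thermodynamic residue in the form the landed transfer consumes). For every
admissible `v` there is `ρ₀ > 0` such that for `0 < ρ < ρ₀` some `c > 0` bounds the constant-mode occupation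
`n₀(Ψ) ≥ cN` for all large `N`, EVERY level `n ∈ ℕ` and every positive real exact minimiser `Ψ` of the periodic `N`-body
energy of the truncation `min(v, n)` on the torus of side `(N/ρ)^{1/3}`. Why plausibly true: every truncation is a
bounded repulsive potential of the same range `R` and scattering length `≤ a(v) ≤ R`, so the whole tower is UNIFORMLY
dilute at `ρR³ ≪ 1`, where Bogoliubov theory predicts condensate fraction `1 − O(√(ρa³))` uniformly; `v = 0`: the tower is
`0`, minimiser = constant, `n₀ = N` ✓; bounded `v`: the tower is eventually `v` itself. It is implied by the route's
`R`-uniform infrared mechanism S2 ∧ S3 (below) through the LANDED `uniformMinimiserBEC_of_bounds` and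
`truncationTowerBEC_of_uniformMinimiserBEC`. Why it might fail: it contains thermodynamic-limit ground-state BEC for
bounded potentials (LSSY2005 Ch. 5: open) AND asks the constants `(ρ₀, c, N₀)` uniform along `n·1_{[0,a)} ↑` hard core —
by the tree's dilation covariance equivalently unit-height spheres of radius `a√n` at density `ρn^{-3/2}`, uniformly in
`n`; no `N₀` uniform in the height is in print. Degenerate members: packed boxes are excluded by `ρ < ρ₀(v)`; `N = 0`
killed by `∀ᶠ`. NOT a worker stub (BEC calibre): the statement to PROMOTE. [cite: LSSY2005, §1.2 (1.19) and Ch. 5 p. 42] -/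
theorem stub_truncationTowerBEC :
    ∀ v : ℝ → ℝ≥0∞, IsRepulsiveFiniteRange v →
      ∃ ρ₀ : ℝ, 0 < ρ₀ ∧ ∀ ρ : ℝ, 0 < ρ → ρ < ρ₀ → ∃ c : ℝ, 0 < c ∧
      ∀ᶠ N : ℕ in atTop, ∀ n : ℕ, ∀ Ψ : PeriodicTrialState N (sideLength ρ N),
        periodicEnergy (fun r => min (v r) (n : ℝ≥0∞)) Ψ =
          periodicGroundStateEnergy (fun r => min (v r) (n : ℝ≥0∞)) N (sideLength ρ N) →
        periodicEnergy (fun r => min (v r) (n : ℝ≥0∞)) Ψ ≠ ⊤ →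
        (∀ X, Ψ.ψ X = (‖Ψ.ψ X‖ : ℂ)) → (∀ X, Ψ.ψ X ≠ 0) →
        ENNReal.ofReal (c * N) ≤ condensateOccupation N (sideLength ρ N) Ψ.ψ := by
  sorry

/-! ## G — dilute hard-sphere connectivity (CONJECTURE; unchanged from v12/v13) -/

/-- **G `stub_lemmaGConnected`** (CONJECTURE — dilute hard-sphere connectivity, VERBATIM the disprover's `LemmaGConnected`
of Disproof §13 with its free region `hardSphereFreeRegion N L b = {X | ∀ i ≠ j, ∀ n ∈ ℤ³, b < ‖Xᵢ − Xⱼ − Ln‖}` written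
out). For every exclusion distance `b > 0` there is `ρ₁ > 0` such that for `0 < ρ < ρ₁` and all large `N`, on the torus of
side `L_N = (N/ρ)^{1/3}` (configurations in `(ℝ³)^N`, all lattice images), any two free configurations are joined INSIDE
the free region up to a relabelling of the spheres. Why plausibly true: dilute hard spheres can be moved past each other
(free volume fraction `1 − O(ρb³)`); isolated finite clusters dissolve by a local homothety; confined clusters are priced
away by kinetic energy anyway. Why it might fail / status: OPEN (Baryshnikov–Bubenik–Kahle IMRN 2014 §6 ask exactly
whether connectivity "ever extends into the thermodynamic limit"; Simányi AHP 2004 assumes it as (2.1.1)); a sparse web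
wrapping the torus that is collectively locked with slack would refute it (locally jammed sparse packings exist —
Böröczky 1964, Kahle 2012 — so sphere-by-sphere peeling is not available; none collectively jammed at low density is
known). Degenerate members: `N ≤ 1` ✓ (no pairs); packed boxes ✓ vacuous. NOT a worker stub: a conjecture item for the
planners. [cite: BaryshnikovBubenikKahle2014, §6] [cite: Simanyi2004, (2.1.1)] -/
theorem stub_lemmaGConnected :
    ∀ b : ℝ, 0 < b → ∃ ρ₁ : ℝ, 0 < ρ₁ ∧ ∀ ρ : ℝ, 0 < ρ → ρ < ρ₁ → ∀ᶠ N : ℕ in atTop,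
      ∀ X ∈ {X : Config N | ∀ i j : Fin N, i ≠ j → ∀ n : Fin 3 → ℤ, b < ‖X i - X j - latticeVec (sideLength ρ N) n‖},
        ∀ Y ∈ {X : Config N | ∀ i j : Fin N, i ≠ j → ∀ n : Fin 3 → ℤ, b < ‖X i - X j - latticeVec (sideLength ρ N) n‖},
          ∃ σ : Equiv.Perm (Fin N),
            JoinedIn {X : Config N | ∀ i j : Fin N, i ≠ j → ∀ n : Fin 3 → ℤ,
              b < ‖X i - X j - latticeVec (sideLength ρ N) n‖} X (Y ∘ σ) := by
  sorry

/-! ## Γ_ess — the level-uniform truncation gap on the ESSENTIAL exotic class (v14: the consumed form of v13's X_ess) -/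

/-- **Γ_ess `stub_essExoticTruncationGap`** (replaces v13's X_ess `stub_diluteMaxFormSimple_essExotic`, which implies it by
the landed `uniformTruncationKyFanGap_of_diluteSimple` — lemma `essGap_of_essExotic` below). For admissible
non-integrable `v` such that NO admissible profile `w` with `w(|x|) = v(|x|)` for a.e. `x ∈ ℝ³` is bounded on `[0,∞)`,
locally bounded on `(0,∞)`, or of the hard-core class (`⊤` on `[0,a)`, bounded on every `(a',∞)`, `a' > a`) — hard or
singular shells, walls accumulating at a positive radius, Cantor walls of positive measure; NO physical potential — there
is `ρ₁ > 0` such that for `0 < ρ < ρ₁`, eventually in `N`, the truncations `min(v,n)` have a Ky Fan gap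
`2E₀(min(v,n)) + γ ≤ kyFanTwo(min(v,n))` with `γ > 0` uniform in the level `n ≥ n₀`. Why plausibly true: the walls cage
clusters whose sectors are priced away uniformly in `N` by kinetic energy (Disproof §13 sector gap), leaving the
principal component (hard spheres of the outer wall radius, Lemma-G-type connectivity) whose maximal-form ground state is
simple, and simplicity of the limit gives the level-uniform gap by the landed pair compactness (P4). Why it might fail:
an accidental tie between globally different components for infinitely many `N`. Degenerate members: `⊤` on a null set /
null decorations of a hard core are NOT members (they have an admissible hard-core or bounded modification); `E₀ = ⊤`
boxes make the inequality trivial (`⊤ ≤ kyFanTwo` fails only if … — excluded: Ruelle finiteness below `ρ₁`). Size XL,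
no physical member: the declared residue of the conjunct's "∀ measurable `v`" quantifier, not for a worker.
[cite: ReedSimonIV1978, Thm XIII.44] -/
theorem stub_essExoticTruncationGap :
    ∀ v : ℝ → ℝ≥0∞, IsRepulsiveFiniteRange v → (∫⁻ x : Space, v ‖x‖) = ⊤ →
      (∀ w : ℝ → ℝ≥0∞, IsRepulsiveFiniteRange w → (∀ᵐ x : Space, v ‖x‖ = w ‖x‖) →
        (¬ ∃ C : ℝ≥0, ∀ r : ℝ, 0 ≤ r → w r ≤ C) ∧
        (¬ ∀ δ : ℝ, 0 < δ → ∃ M : ℝ≥0∞, M ≠ ⊤ ∧ ∀ r : ℝ, δ < r → w r ≤ M) ∧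
        (¬ ∃ a : ℝ, 0 < a ∧ (∀ r : ℝ, 0 ≤ r → r < a → w r = ⊤) ∧
          ∀ a' : ℝ, a < a' → ∃ M : ℝ≥0∞, M ≠ ⊤ ∧ ∀ r : ℝ, a' < r → w r ≤ M)) →
      ∃ ρ₁ : ℝ, 0 < ρ₁ ∧ ∀ ρ : ℝ, 0 < ρ → ρ < ρ₁ → ∀ᶠ N : ℕ in atTop,
        ∃ γ : ℝ, 0 < γ ∧ ∃ n₀ : ℕ, ∀ n : ℕ, n₀ ≤ n →
          2 * periodicGroundStateEnergy (fun r => min (v r) (n : ℝ≥0∞)) N (sideLength ρ N) +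
              ENNReal.ofReal γ ≤
            kyFanTwo (fun r => min (v r) (n : ℝ≥0∞)) N (sideLength ρ N) := by
  sorry

/-! ## Documentation: v13's stubs imply v14's (landed implications; S2, S3, X_ess are NOT obligations of v14) -/

/-- v13's S2 ∧ S3 (the route's `R`-uniform infrared mechanism) imply T: S2 → S3 → U(R) (`uniformMinimiserBEC_of_bounds`,
landed p128010) and U(R) → T(v) (`truncationTowerBEC_of_uniformMinimiserBEC`, landed p129328). [folklore] -/
theorem towerBEC_of_bounds
    (hS2 : ∀ R : ℝ, 0 < R → ∃ C : ℝ, 0 < C ∧ ∃ ρ₀ : ℝ, 0 < ρ₀ ∧ ∀ ρ : ℝ, 0 < ρ → ρ < ρ₀ →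
    ∀ᶠ n : ℕ in atTop, ∀ v : ℝ → ℝ≥0∞, IsRepulsiveFiniteRange v →
    (∃ M : ℝ≥0∞, M ≠ ⊤ ∧ ∀ r, v r ≤ M) → (∀ r, R < r → v r = 0) →
    ∀ Ψ : PeriodicTrialState (n + 1) (sideLength ρ (n + 1)),
    periodicEnergy v Ψ = periodicGroundStateEnergy v (n + 1) (sideLength ρ (n + 1)) →
    periodicEnergy v Ψ ≠ ⊤ → (∀ X, Ψ.ψ X = (‖Ψ.ψ X‖ : ℂ)) → (∀ X, Ψ.ψ X ≠ 0) →
    ∀ m : Fin 3 → ℤ, m ≠ 0 →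
    (∫ X in cellN (n + 1) (sideLength ρ (n + 1)),
    ‖∑ j : Fin (n + 1), cellWave (sideLength ρ (n + 1)) m (X j) *
    fderiv ℝ Ψ.ψ X
    (Pi.single j ((2 * Real.pi / sideLength ρ (n + 1)) • latticeVec 1 m))‖ ^ 2) ≤
    C * ρ * ‖(2 * Real.pi / sideLength ρ (n + 1)) • latticeVec 1 m‖ ^ 2 * ((n : ℝ) + 1))
    (hS3 : ∀ R : ℝ, 0 < R → ∃ C : ℝ, 0 ≤ C ∧ ∃ ρ₀ : ℝ, 0 < ρ₀ ∧ ∀ ρ : ℝ, 0 < ρ → ρ < ρ₀ →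
    ∀ᶠ n : ℕ in atTop, ∀ v : ℝ → ℝ≥0∞, IsRepulsiveFiniteRange v →
    (∃ M : ℝ≥0∞, M ≠ ⊤ ∧ ∀ r, v r ≤ M) → (∀ r, R < r → v r = 0) →
    ∀ Ψ : PeriodicTrialState (n + 1) (sideLength ρ (n + 1)),
    (let L : ℝ := sideLength ρ (n + 1)
    let g : Space → ℝ := fun r => ∫ x in cell L, ∫ Y in cellN n L,
    ‖Ψ.ψ (Matrix.vecCons (x + r) Y)‖ * ‖Ψ.ψ (Matrix.vecCons x Y)‖
    let ν : (Fin 3 → ℤ) → ℝ := fun m =>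
    (cellFourierCoeff L (fun r : Space => ((Real.log (g r) : ℝ) : ℂ)) m).re
    let S : (Fin 3 → ℤ) → ℝ := fun m => ((n : ℝ) + 1)⁻¹ *
    ∫ X in cellN (n + 1) L, ‖∑ j : Fin (n + 1), cellWave L m (X j)‖ ^ 2 * ‖Ψ.ψ X‖ ^ 2
    periodicEnergy v Ψ = periodicGroundStateEnergy v (n + 1) L → periodicEnergy v Ψ ≠ ⊤ →
    (∀ X, Ψ.ψ X = (‖Ψ.ψ X‖ : ℂ)) → (∀ X, Ψ.ψ X ≠ 0) →
    ∀ m : Fin 3 → ℤ, m ≠ 0 → ((n : ℝ) + 1) * ν m * S m ≤ C)) :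
    ∀ v : ℝ → ℝ≥0∞, IsRepulsiveFiniteRange v →
      ∃ ρ₀ : ℝ, 0 < ρ₀ ∧ ∀ ρ : ℝ, 0 < ρ → ρ < ρ₀ → ∃ c : ℝ, 0 < c ∧
      ∀ᶠ N : ℕ in atTop, ∀ n : ℕ, ∀ Ψ : PeriodicTrialState N (sideLength ρ N),
        periodicEnergy (fun r => min (v r) (n : ℝ≥0∞)) Ψ =
          periodicGroundStateEnergy (fun r => min (v r) (n : ℝ≥0∞)) N (sideLength ρ N) →
        periodicEnergy (fun r => min (v r) (n : ℝ≥0∞)) Ψ ≠ ⊤ →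
        (∀ X, Ψ.ψ X = (‖Ψ.ψ X‖ : ℂ)) → (∀ X, Ψ.ψ X ≠ 0) →
        ENNReal.ofReal (c * N) ≤ condensateOccupation N (sideLength ρ N) Ψ.ψ := by
  intro v hv
  obtain ⟨R, hR, hvR⟩ := hv.exists_pos_range
  exact truncationTowerBEC_of_uniformMinimiserBEC (uniformMinimiserBEC_of_bounds hS2 hS3 R hR) v hv hvR

/-- v13's X_ess implies Γ_ess (`uniformTruncationKyFanGap_of_diluteSimple`, landed p127320): the reshape only WEAKENS
the stub. [folklore] -/
theorem essGap_of_essExotic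
    (hX : ∀ v : ℝ → ℝ≥0∞, IsRepulsiveFiniteRange v → (∫⁻ x : Space, v ‖x‖) = ⊤ →
      (∀ w : ℝ → ℝ≥0∞, IsRepulsiveFiniteRange w → (∀ᵐ x : Space, v ‖x‖ = w ‖x‖) →
        (¬ ∃ C : ℝ≥0, ∀ r : ℝ, 0 ≤ r → w r ≤ C) ∧
        (¬ ∀ δ : ℝ, 0 < δ → ∃ M : ℝ≥0∞, M ≠ ⊤ ∧ ∀ r : ℝ, δ < r → w r ≤ M) ∧
        (¬ ∃ a : ℝ, 0 < a ∧ (∀ r : ℝ, 0 ≤ r → r < a → w r = ⊤) ∧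
          ∀ a' : ℝ, a < a' → ∃ M : ℝ≥0∞, M ≠ ⊤ ∧ ∀ r : ℝ, a' < r → w r ≤ M)) →
      ∃ ρ₁ : ℝ, 0 < ρ₁ ∧ ∀ ρ : ℝ, 0 < ρ → ρ < ρ₁ → ∀ᶠ N : ℕ in atTop,
        periodicGroundStateEnergy v N (sideLength ρ N) ≠ ⊤ →
        ∀ η θ : Lp ℂ 2 (volume : Measure (UnitAddTorus (Fin N × Fin 3))),
          η ∈ maxFormGroundStates v N (sideLength ρ N) → θ ∈ maxFormGroundStates v N (sideLength ρ N) →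
          η ≠ 0 → θ ≠ 0 → ⟪η, θ⟫_ℂ ≠ 0) :
    ∀ v : ℝ → ℝ≥0∞, IsRepulsiveFiniteRange v → (∫⁻ x : Space, v ‖x‖) = ⊤ →
      (∀ w : ℝ → ℝ≥0∞, IsRepulsiveFiniteRange w → (∀ᵐ x : Space, v ‖x‖ = w ‖x‖) →
        (¬ ∃ C : ℝ≥0, ∀ r : ℝ, 0 ≤ r → w r ≤ C) ∧
        (¬ ∀ δ : ℝ, 0 < δ → ∃ M : ℝ≥0∞, M ≠ ⊤ ∧ ∀ r : ℝ, δ < r → w r ≤ M) ∧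
        (¬ ∃ a : ℝ, 0 < a ∧ (∀ r : ℝ, 0 ≤ r → r < a → w r = ⊤) ∧
          ∀ a' : ℝ, a < a' → ∃ M : ℝ≥0∞, M ≠ ⊤ ∧ ∀ r : ℝ, a' < r → w r ≤ M)) →
      ∃ ρ₁ : ℝ, 0 < ρ₁ ∧ ∀ ρ : ℝ, 0 < ρ → ρ < ρ₁ → ∀ᶠ N : ℕ in atTop,
        ∃ γ : ℝ, 0 < γ ∧ ∃ n₀ : ℕ, ∀ n : ℕ, n₀ ≤ n →
          2 * periodicGroundStateEnergy (fun r => min (v r) (n : ℝ≥0∞)) N (sideLength ρ N) +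
              ENNReal.ofReal γ ≤
            kyFanTwo (fun r => min (v r) (n : ℝ≥0∞)) N (sideLength ρ N) :=
  fun v hv hint hno => uniformTruncationKyFanGap_of_diluteSimple v hv (hX v hv hint hno)

/-! ## The composition: the stubs give the crux BY NAME -/

/-- **`HardCoreExtension` from the line `third-law-current-floor`** (kernel-checked; no `sorry` of its own; the only
hypothesis is the ROUTE ITEM `BoundaryTransferWeak` (stmt-0827) BY NAME; the antecedent `A` is idle, Disproof §1). It
is literally the landed `hardCoreExtension_of_towerBEC` (p129328) fed with the three sorried stubs T, G, Γ_ess. -/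
theorem HardCoreExtension_of (hbt : BoundaryTransferWeak) : HardCoreExtension :=
  hardCoreExtension_of_towerBEC stub_truncationTowerBEC stub_lemmaGConnected stub_essExoticTruncationGap hbt

/-- The hard-sphere headline of the line, from the stubs T and G only (landed `diluteBEC_hardSpheres_of_towerBEC_of_lemmaG`):
height-uniform soft-sphere minimiser BEC + G + `BoundaryTransferWeak` ⇒ dilute `HasGroundStateBEC (hardCorePotential a)`.
[cite: LSSY2005, §1.2 (1.19) and Ch. 5 p. 42] -/
theorem diluteBEC_hardSpheres_of (hbt : BoundaryTransferWeak) {a : ℝ} (ha : 0 < a) :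
    ∃ ρ₀ : ℝ, 0 < ρ₀ ∧ ∀ ρ : ℝ, 0 < ρ → ρ < ρ₀ → HasGroundStateBEC (hardCorePotential a) ρ :=
  diluteBEC_hardSpheres_of_towerBEC_of_lemmaG ha
    (stub_truncationTowerBEC _ (isRepulsiveFiniteRange_hardCorePotential a)) stub_lemmaGConnected hbt

end Summit.AtomisticToContinuum.BoseEinsteinCondensation.Cruxes.HardCoreExtension.ThirdLawCurrentFloorAlt
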